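import Summits.QuantumFields.GaugeBoot.BootstrapSymmetryConsequences
import Summits.QuantumFields.GaugeBoot.WilsonLineObservables
import HarnessLib

/-!
# Internal symmetries of the bootstrap: automorphisms of the gauge group (gauge-boot, L1 supplement)

HONEST FRAMING (cell `pub-gaugeboot`, page 1 of every file): the venture produces certified bounds
on lattice expectations at stated coupling, gauge group, dimension and torus size; NOT a mass gap,
NOT a continuum limit, NOT a string tension; NOT Yang–Mills-summit-bearing (barriers
`FixedCouplingUltralocality`, `PerturbativeInvisibility`). Structural; it certifies no number.

## Content

Besides the lattice symmetries, a lattice bootstrap imposes the INTERNAL symmetry "Wilson loops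
are real / `W[C̄] = W[C]`", i.e. invariance under charge conjugation `U ↦ Ū`. This file treats a
general continuous INVOLUTIVE AUTOMORPHISM `c` of the compact gauge group acting on configurations
link by link (`autCM c`, `U ↦ c ∘ U`); the sequel `BootstrapChargeConjugation.lean` instantiates it
with complex conjugation on `SU(N)` / `U(N)`.

* `autCM_update` — `c ∘ (U[e ↦ g U_e]) = (c ∘ U)[e ↦ c(g) (c ∘ U)_e]`: a one-link shift along the
  family `k_a` is carried to the shift along `c ∘ k_a` — a relabelling of DIRECTIONS, not of links;
* `comp_autCM_mem_polyAlgebra` — polynomial stability (from the generators, `hgen`);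
* ★★ `IsSDFunctional.comp_aut` — if `c` permutes the one-parameter families (`c (k a t) = k (ā a) t`)
  and leaves the local actions invariant, then `φ ↦ φ ∘ (autCM c)^*` preserves the loop equations;
* `wordHolonomy_comp_aut`, `wilsonAction_comp_aut` — holonomies are mapped by `c`, so the Wilson action
  is invariant as soon as `Re tr ρ ∘ c = Re tr ρ`; ★★ `measurePreserving_autEquiv_wilsonMeasure` — then
  the Wilson measure is invariant (Haar measure is preserved by continuous surjective endomorphisms of
  a compact group — Mathlib `MonoidHom.measurePreserving` — factor by factor, `measurePreserving_pi`);
  `integral_comp_aut_eq_wilson`;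
* ★★★ `bootstrap_autInvariant_suN` / `_uN` — every solution of the untruncated `SU(N)` / `U(N)`
  bootstrap is invariant under every such automorphism (`bootstrap_invariant_suN`).

References: M. Creutz, *Quarks, gluons and lattices* (1983) Ch. 8; V. Kazakov, Z. Zheng,
arXiv:2203.11360 §3.2 (reality / orientation reversal of Wilson loops). Folklore.
-/

noncomputable section

open MeasureTheory Filter Topology NormedSpace
open Literature.MathematicalPhysics.QuantumFieldTheory (haarProbability LatticeRep Site Edge GaugeConfig
  plaquetteHolonomy wilsonAction wilsonWeight wilsonMeasure partitionFunction isProbabilityMeasure_wilsonMeasure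
  withDensity_map_of_measurableEquiv)

namespace Summit.QuantumFields.GaugeBoot

/-! ## Automorphisms acting on configurations -/

section General

variable {ι : Type*} {G : Type*} [Group G] [TopologicalSpace G] (c : G →* G) (hcc : Continuous c)

/-- **A continuous endomorphism of the gauge group acting link by link**: `U ↦ c ∘ U`. [folklore] -/
def autCM : C(ι → G, ι → G) :=
  ⟨fun U => c ∘ U, continuous_pi fun e => hcc.comp (continuous_apply e)⟩

/-- `autCM` evaluated. -/
@[simp] theorem autCM_apply (U : ι → G) (e : ι) : autCM (ι := ι) c hcc U e = c (U e) := rfl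

/-- `autCM` as a function. -/
theorem coe_autCM : ⇑(autCM (ι := ι) c hcc) = fun U => c ∘ U := rfl

/-- **`c` carries the one-link shift by `g` to the one-link shift by `c g`.** -/
theorem autCM_update [DecidableEq ι] (U : ι → G) (e : ι) (g : G) :
    autCM (ι := ι) c hcc (Function.update U e (g * U e)) = Function.update (autCM (ι := ι) c hcc U) e (c g * c (U e)) := by
  funext e'
  by_cases h : e' = e
  · subst h; simp
  · simp [Function.update_of_ne h]

variable (r : LatticeRep G)

/-- **Polynomial stability**, from the generators: if every `Re/Im ρ(c(U_e))_{ab}` is a polynomial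
observable then so is `f ∘ (c ∘ ·)` for every polynomial `f`. [folklore] -/
theorem comp_autCM_mem_polyAlgebra
    (hgen : ∀ (e : ι) (a b : Fin r.N), (reEntry r e a b).comp (autCM (ι := ι) c hcc) ∈ polyAlgebra (ι := ι) r ∧
      (imEntry r e a b).comp (autCM (ι := ι) c hcc) ∈ polyAlgebra (ι := ι) r)
    {f : C(ι → G, ℝ)} (hf : f ∈ polyAlgebra (ι := ι) r) : f.comp (autCM (ι := ι) c hcc) ∈ polyAlgebra (ι := ι) r := by
  have h : polyAlgebra (ι := ι) r ≤ (polyAlgebra (ι := ι) r).comap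
      (ContinuousMap.compRightAlgHom ℝ ℝ (autCM (ι := ι) c hcc)) := by
    refine Algebra.adjoin_le ?_
    rintro _ (⟨⟨e, a, b⟩, rfl⟩ | ⟨⟨e, a, b⟩, rfl⟩)
    · exact (hgen e a b).1
    · exact (hgen e a b).2
  exact h hf

variable [DecidableEq ι] {K : Type*} {k : K → ℝ → G} {S : ι → (ι → G) → ℝ} {β : ℝ}

/-- ★★ **An automorphism permuting the one-parameter families and fixing the local actions preserves
the loop equations**: with `c (k a t) = k (ā a) t` for an involution `ā` of the directions and
`S e (c ∘ U) = S e U`, if `φ` is a Schwinger–Dyson functional then so is `f ↦ φ (f ∘ (c ∘ ·))` (its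
row at `(e, a)` is the row of `φ` at `(e, ā a)` with test function `f ∘ (c ∘ ·)`). [folklore] -/
theorem IsSDFunctional.comp_aut (ā : K → K) (hā : ∀ a, ā (ā a) = a) (hdir : ∀ a t, c (k a t) = k (ā a) t)
    (hS : ∀ e U, S e (c ∘ U) = S e U)
    (hgen : ∀ (e : ι) (a b : Fin r.N), (reEntry r e a b).comp (autCM (ι := ι) c hcc) ∈ polyAlgebra (ι := ι) r ∧
      (imEntry r e a b).comp (autCM (ι := ι) c hcc) ∈ polyAlgebra (ι := ι) r)
    {φ : C(ι → G, ℝ) →ₗ[ℝ] ℝ} (hφ : IsSDFunctional r k S β φ) :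
    IsSDFunctional r k S β (φ ∘ₗ (ContinuousMap.compRightAlgHom ℝ ℝ (autCM (ι := ι) c hcc)).toLinearMap) := by
  intro e a
  obtain ⟨S', hS'm, hS', -⟩ := hφ e a
  obtain ⟨S₂, hS₂m, hS₂, hrow₂⟩ := hφ e (ā a)
  refine ⟨S', hS'm, hS', fun f hf f' hf'm hf' => ?_⟩
  change φ (f'.comp (autCM c hcc)) = β * φ ((f * S').comp (autCM c hcc))
  -- the shift along `k (ā a)` at `U`, composed with `c`, is the shift along `k a` at `c ∘ U`
  have hflip : ∀ (h : (ι → G) → ℝ) (U : ι → G),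
      (fun t => h (autCM (ι := ι) c hcc (Function.update U e (k (ā a) t * U e)))) =
        fun t => h (Function.update (autCM (ι := ι) c hcc U) e (k a t * autCM (ι := ι) c hcc U e)) := fun h U => by
    funext t
    rw [autCM_update, hdir, hā, autCM_apply]
  have hF' : ∀ U, HasDerivAt (fun t => (f.comp (autCM c hcc)) (Function.update U e (k (ā a) t * U e)))
      ((f'.comp (autCM c hcc)) U) 0 := fun U => by
    simp only [ContinuousMap.comp_apply]
    rw [hflip]
    exact hf' _
  have hS₂' : ∀ U, S₂ U = S' (autCM (ι := ι) c hcc U) := fun U => by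
    have h3 : HasDerivAt (fun t => S e (Function.update U e (k (ā a) t * U e))) (S' (autCM (ι := ι) c hcc U)) 0 := by
      have hfun : (fun t => S e (Function.update U e (k (ā a) t * U e))) =
          fun t => S e (autCM (ι := ι) c hcc (Function.update U e (k (ā a) t * U e))) := by
        funext t; rw [coe_autCM, hS]
      rw [hfun, hflip]
      exact hS' _
    exact (hS₂ U).unique h3
  have hrow := hrow₂ (f.comp (autCM c hcc)) (comp_autCM_mem_polyAlgebra c hcc r hgen hf) (f'.comp (autCM c hcc))
    (comp_autCM_mem_polyAlgebra c hcc r hgen hf'm) hF'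
  have hprod : f.comp (autCM c hcc) * S₂ = (f * S').comp (autCM (ι := ι) c hcc) := by
    ext U
    simp [hS₂']
  rwa [hprod] at hrow

end General

/-! ## The torus: holonomies, Wilson action and Wilson measure under an automorphism -/

section Torus

variable {d L : ℕ} {G : Type*} [Group G] (c : G →* G)

/-- **Holonomies are mapped by the automorphism**: `hol_x(w)(c ∘ U) = c (hol_x(w)(U))`. -/
theorem wordHolonomy_comp_aut (U : GaugeConfig d L G) (x : Site d L) (w : Word d) :
    wordHolonomy (c ∘ U) x w = c (wordHolonomy U x w) := by
  induction w generalizing x with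
  | nil => simp
  | cons s w ih =>
    rw [wordHolonomy_cons, wordHolonomy_cons, map_mul, ih]
    cases s <;> simp

/-- Plaquette holonomies are mapped by the automorphism. -/
theorem plaquetteHolonomy_comp_aut (U : GaugeConfig d L G) (x : Site d L) (i j : Fin d) :
    plaquetteHolonomy (c ∘ U) x i j = c (plaquetteHolonomy U x i j) := by
  simp [plaquetteHolonomy]

variable {N : ℕ} (ρ : G →* Matrix (Fin N) (Fin N) ℂ)

/-- **The Wilson action is invariant** when `Re tr ρ(c g) = Re tr ρ(g)`. -/
theorem wilsonAction_comp_aut [NeZero L] (htr : ∀ g, (ρ (c g)).trace.re = (ρ g).trace.re) (U : GaugeConfig d L G) :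
    wilsonAction ρ (c ∘ U) = wilsonAction ρ U := by
  unfold wilsonAction
  simp_rw [plaquetteHolonomy_comp_aut, htr]

variable [TopologicalSpace G] [IsTopologicalGroup G] [CompactSpace G] [MeasurableSpace G] [BorelSpace G]
  [SecondCountableTopology G] [NeZero L]

/-- The link-by-link action of a continuous involutive automorphism as a measurable equivalence. -/
def autEquiv (hcc : Continuous c) (hci : Function.Involutive c) : GaugeConfig d L G ≃ᵐ GaugeConfig d L G where
  toFun U := c ∘ U
  invFun U := c ∘ U
  left_inv U := funext fun e => hci (U e)
  right_inv U := funext fun e => hci (U e)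
  measurable_toFun := (autCM (ι := Edge d L) c hcc).continuous.measurable
  measurable_invFun := (autCM (ι := Edge d L) c hcc).continuous.measurable

omit [IsTopologicalGroup G] [CompactSpace G] in
/-- `autEquiv` as a function. -/
@[simp] theorem coe_autEquiv (hcc : Continuous c) (hci : Function.Involutive c) :
    ⇑(autEquiv (d := d) (L := L) c hcc hci) = fun U => c ∘ U := rfl

/-- **Haar measure is preserved factor by factor** (Mathlib `MonoidHom.measurePreserving`:
a continuous surjective endomorphism of a compact group preserves its Haar probability). -/
theorem map_autEquiv_pi_haar (hcc : Continuous c) (hci : Function.Involutive c) :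
    (Measure.pi fun _ : Edge d L => haarProbability G).map (autEquiv (d := d) (L := L) c hcc hci) =
      Measure.pi fun _ : Edge d L => haarProbability G := by
  have h1 : MeasurePreserving c (haarProbability G) (haarProbability G) :=
    MonoidHom.measurePreserving hcc hci.surjective rfl
  exact (measurePreserving_pi (fun _ : Edge d L => haarProbability G) (fun _ : Edge d L => haarProbability G)
    (f := fun _ => c) fun _ => h1).map_eq

/-- ★★ **The Wilson measure is invariant under the automorphism** (`Re tr ρ ∘ c = Re tr ρ`). [folklore] -/
theorem measurePreserving_autEquiv_wilsonMeasure (hcc : Continuous c) (hci : Function.Involutive c)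
    (htr : ∀ g, (ρ (c g)).trace.re = (ρ g).trace.re) (β : ℝ) :
    MeasurePreserving (autEquiv (d := d) (L := L) c hcc hci) (wilsonMeasure (d := d) (L := L) ρ β) (wilsonMeasure ρ β) := by
  refine ⟨(autEquiv (d := d) (L := L) c hcc hci).measurable, ?_⟩
  simp only [wilsonMeasure, Measure.map_smul, wilsonWeight]
  rw [withDensity_map_of_measurableEquiv _ _ _ (map_autEquiv_pi_haar c hcc hci)]
  intro U
  rw [coe_autEquiv, wilsonAction_comp_aut c ρ htr]

/-- **Change of variables**: `∫ f (c ∘ U) dμ_Wilson = ∫ f dμ_Wilson`. -/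
theorem integral_comp_aut_eq_wilson (hcc : Continuous c) (hci : Function.Involutive c)
    (htr : ∀ g, (ρ (c g)).trace.re = (ρ g).trace.re) (β : ℝ) (f : C(GaugeConfig d L G, ℝ)) :
    ∫ U, f (c ∘ U) ∂(wilsonMeasure ρ β) = ∫ U, f U ∂(wilsonMeasure (d := d) (L := L) ρ β) :=
  (measurePreserving_autEquiv_wilsonMeasure c ρ hcc hci htr β).integral_comp' f

end Torus

/-! ## `SU(N)` and `U(N)`: every solution is invariant under every such automorphism -/

section Unitary

open Literature.MathematicalPhysics.QuantumLattice

variable {d L : ℕ} [NeZero L] (N : ℕ) (β : ℝ)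

/-- ★★★ **`SU(N)`: every solution of the untruncated bootstrap is invariant under every continuous
involutive automorphism of `SU(N)` preserving `Re tr` and the polynomial observables** (applied link
by link) — e.g. charge conjugation (sequel). [folklore] -/
theorem bootstrap_autInvariant_suN (c : Matrix.specialUnitaryGroup (Fin N) ℂ →* Matrix.specialUnitaryGroup (Fin N) ℂ)
    (hcc : Continuous c) (hci : Function.Involutive c)
    (htr : ∀ g, (fundamentalRep (Fin N) (c g)).trace.re = (fundamentalRep (Fin N) g).trace.re)
    (hgen : ∀ (e : Edge d L) (a b : Fin N),
      (reEntry (fundamentalLatticeRep N) e a b).comp (autCM (ι := Edge d L) c hcc) ∈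
          polyAlgebra (ι := Edge d L) (fundamentalLatticeRep N) ∧
        (imEntry (fundamentalLatticeRep N) e a b).comp (autCM (ι := Edge d L) c hcc) ∈
          polyAlgebra (ι := Edge d L) (fundamentalLatticeRep N))
    {φ : C(GaugeConfig d L (Matrix.specialUnitaryGroup (Fin N) ℂ), ℝ) →ₗ[ℝ] ℝ} (h1 : φ 1 = 1)
    (hpos : ∀ a ∈ polyAlgebra (ι := Edge d L) (fundamentalLatticeRep N), 0 ≤ φ (a * a))
    (hφ : IsSDFunctional (fundamentalLatticeRep N) (suExp N) (fun _ => wilsonAction (fundamentalRep (Fin N))) β φ)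
    {f : C(GaugeConfig d L (Matrix.specialUnitaryGroup (Fin N) ℂ), ℝ)}
    (hf : f ∈ polyAlgebra (ι := Edge d L) (fundamentalLatticeRep N)) :
    φ (f.comp (autCM (ι := Edge d L) c hcc)) = φ f :=
  bootstrap_invariant_suN N β h1 hpos hφ _
    (fun g => integral_comp_aut_eq_wilson c (fundamentalRep (Fin N)) hcc hci htr β g)
    (fun _ hg => comp_autCM_mem_polyAlgebra c hcc _ hgen hg) hf

/-- ★★★ **`U(N)`: every solution of the untruncated bootstrap is invariant under every continuous
involutive `Re tr`-preserving, polynomial-stable automorphism of `U(N)`.** [folklore] -/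
theorem bootstrap_autInvariant_uN (c : Matrix.unitaryGroup (Fin N) ℂ →* Matrix.unitaryGroup (Fin N) ℂ)
    (hcc : Continuous c) (hci : Function.Involutive c)
    (htr : ∀ g, (unitaryFundamentalRep (Fin N) ℂ (c g)).trace.re = (unitaryFundamentalRep (Fin N) ℂ g).trace.re)
    (hgen : ∀ (e : Edge d L) (a b : Fin N),
      (reEntry (unitaryFundamentalLatticeRep N) e a b).comp (autCM (ι := Edge d L) c hcc) ∈
          polyAlgebra (ι := Edge d L) (unitaryFundamentalLatticeRep N) ∧
        (imEntry (unitaryFundamentalLatticeRep N) e a b).comp (autCM (ι := Edge d L) c hcc) ∈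
          polyAlgebra (ι := Edge d L) (unitaryFundamentalLatticeRep N))
    {φ : C(GaugeConfig d L (Matrix.unitaryGroup (Fin N) ℂ), ℝ) →ₗ[ℝ] ℝ} (h1 : φ 1 = 1)
    (hpos : ∀ a ∈ polyAlgebra (ι := Edge d L) (unitaryFundamentalLatticeRep N), 0 ≤ φ (a * a))
    (hφ : IsSDFunctional (unitaryFundamentalLatticeRep N) (uExp N)
      (fun _ => wilsonAction (unitaryFundamentalRep (Fin N) ℂ)) β φ)
    {f : C(GaugeConfig d L (Matrix.unitaryGroup (Fin N) ℂ), ℝ)}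
    (hf : f ∈ polyAlgebra (ι := Edge d L) (unitaryFundamentalLatticeRep N)) :
    φ (f.comp (autCM (ι := Edge d L) c hcc)) = φ f :=
  bootstrap_invariant_uN N β h1 hpos hφ _
    (fun g => integral_comp_aut_eq_wilson c (unitaryFundamentalRep (Fin N) ℂ) hcc hci htr β g)
    (fun _ hg => comp_autCM_mem_polyAlgebra c hcc _ hgen hg) hf

end Unitary

end Summit.QuantumFields.GaugeBoot

end
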